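import Mathlib.Algebra.QuadraticDiscriminant
import Literature.LinearAlgebra.QuadraticForm.WittDecomposition
import Literature.LinearAlgebra.QuadraticForm.WittClassZero
import HarnessLib

/-!
# The Witt group of a Euclidean ordered field is `ℤ` by the signature ([LionVergne1980, A.6 Remark])

Topic `LinearAlgebra/QuadraticForm`; namespace `Literature.LinearAlgebra.QuadraticForm`. KERNEL mathematics only
(theorems + one `AddEquiv` with body; no named fact, no `axiom`, no `sorry`). [LionVergne1980, Appendix A.6,
Remark]: "If `k = ℝ`, the map `s(E, Q) = sign Q` defines an isomorphism of `W_k` with `ℤ`." `WittGroup.lean` has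
the homomorphism `WittGroup.sign : W(𝕜) →+ ℤ` for every ordered field; here, for an ordered field in which every
positive element is a square (e.g. `ℝ`), it is shown to be bijective:

* §1 `sigPos_eq_zero_or_sigNeg_eq_zero_of_anisotropic`: an anisotropic form over such a field is definite (if
  `Q(u) > 0 > Q(v)` the quadratic `t ↦ Q(u + t v)` has a root — discriminant `> 0`).
* §2 `WittGroup.sign_injective`: `sign {Q} = 0 ⇒ {Q} = 0` (radical splitting, Witt decomposition `Q̂ ≅ Q₀ ⊥ M`, §1
  forces `Q₀ = 0`, so `Q` has a Lagrangian); `WittGroup.sign_surjective` (`sign {⟨1⟩} = 1`);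
  `WittGroup.signEquiv : W(𝕜) ≃+ ℤ`; `WittGroup.signEquivReal : W(ℝ) ≃+ ℤ`.

## References

* [LionVergne1980] G. Lion, M. Vergne, *The Weil representation, Maslov index and Theta series*, Birkhäuser
  (1980), Appendix to Part I, A.6, Remark.
* [Knebusch2010] M. Knebusch, *Specialization of Quadratic and Symmetric Bilinear Forms*, Springer (2010), Ch. 1
  §1.2 — Witt decomposition, through `WittDecomposition.lean`.
-/

set_option autoImplicit false

noncomputable section

open QuadraticMap Module

namespace Literature.LinearAlgebra.QuadraticForm

universe u v

variable {𝕜 : Type u} [Field 𝕜] [LinearOrder 𝕜] [IsStrictOrderedRing 𝕜]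
variable {V : Type v} [AddCommGroup V] [Module 𝕜 V] [FiniteDimensional 𝕜 V]

/-! ## §1 Anisotropic forms over a Euclidean ordered field are definite -/

/-- an anisotropic form has trivial radical (radical vectors are isotropic), hence is a quadratic space (`2 ≠ 0`).
[cite: Knebusch2010, Ch. 1 §1.2 (1)] -/
private theorem nondegenerate_polarForm_of_anisotropic' {K : Type u} [Field K] [NeZero (2 : K)] {W : Type v}
    [AddCommGroup W] [Module K W] {Q : QuadraticForm K W} (h : Q.Anisotropic) : (polarForm Q).Nondegenerate := by
  refine nondegenerate_polarForm_of_radical_eq_bot (eq_bot_iff.2 fun r hr => ?_)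
  rw [Submodule.mem_bot]
  exact h r (QuadraticMap.mem_radical_iff'.1 hr).1

/-- **over an ordered field with square roots of positive elements, an anisotropic form is definite**: it cannot
have both a positive and a negative value (`sigPos Q = 0 ∨ sigNeg Q = 0`), since for `Q(u) > 0 > Q(v)` the
polynomial `Q(u + t v) = Q(v) t² + B(u, v) t + Q(u)` has positive discriminant, hence a root.
[cite: LionVergne1980, Appendix A.6, Remark] -/
theorem sigPos_eq_zero_or_sigNeg_eq_zero_of_anisotropic (hsq : ∀ a : 𝕜, 0 < a → ∃ b : 𝕜, b * b = a)
    {Q : QuadraticForm 𝕜 V} (h : Q.Anisotropic) : sigPos Q = 0 ∨ sigNeg Q = 0 := by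
  by_contra hcon
  rw [not_or] at hcon
  -- a vector with `Q u > 0`
  obtain ⟨Vp, hVp, hpos⟩ := exists_finrank_eq_sigPos_and_posDef Q
  obtain ⟨u, huV, hu⟩ := (Submodule.ne_bot_iff Vp).1 (fun hb => by
    rw [hb, finrank_bot] at hVp; exact hcon.1 hVp.symm)
  have hQu : 0 < Q u := by
    have e := hpos ⟨u, huV⟩ (fun h0 => hu (congrArg Subtype.val h0))
    exact e
  -- a vector with `Q v < 0`
  obtain ⟨Vn, hVn, hneg⟩ := exists_finrank_eq_sigPos_and_posDef (-Q)
  rw [sigPos_neg] at hVn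
  obtain ⟨v, hvV, hv⟩ := (Submodule.ne_bot_iff Vn).1 (fun hb => by
    rw [hb, finrank_bot] at hVn; exact hcon.2 hVn.symm)
  have hQv : Q v < 0 := by
    have e := hneg ⟨v, hvV⟩ (fun h0 => hv (congrArg Subtype.val h0))
    change 0 < -Q v at e
    linarith
  -- a root of `Q(u + t v) = Q v * t² + polar Q u v * t + Q u`
  have hdisc : ∃ s : 𝕜, discrim (Q v) (polar Q u v) (Q u) = s * s := by
    obtain ⟨s, hs⟩ := hsq (discrim (Q v) (polar Q u v) (Q u)) (by
      rw [discrim]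
      nlinarith [sq_nonneg (polar Q u v), mul_pos_of_neg_of_neg hQv (show -(4 * Q u) < 0 by linarith)])
    exact ⟨s, hs.symm⟩
  obtain ⟨t, ht⟩ := exists_quadratic_eq_zero hQv.ne hdisc
  have hroot : Q (u + t • v) = 0 := by
    rw [map_add_eq_polar Q, QuadraticMap.map_smul, QuadraticMap.polar_smul_right, smul_eq_mul, smul_eq_mul]
    linear_combination ht
  have hzero := h _ hroot
  -- then `u = -t v` and `Q u = t² Q v ≤ 0`, contradiction
  have hu' : u = -(t • v) := eq_neg_of_add_eq_zero_left hzero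
  have e : Q u = t * t * Q v := by rw [hu', QuadraticMap.map_neg, QuadraticMap.map_smul, smul_eq_mul]
  nlinarith [mul_self_nonneg t]

/-! ## §2 `sign : W(𝕜) ≃ ℤ` -/

namespace WittGroup

/-- **`sign` is injective** on the Witt group of an ordered field with square roots of positives: a class of
signature `0` is `0` (its quadratic space is `Q₀ ⊥ M` with `Q₀` anisotropic of signature `0`, hence `Q₀ = 0` by §1,
so the form has a Lagrangian). [cite: LionVergne1980, Appendix A.6, Remark] -/
theorem sign_injective (hsq : ∀ a : 𝕜, 0 < a → ∃ b : 𝕜, b * b = a) :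
    Function.Injective (sign : WittGroup 𝕜 →+ ℤ) := by
  refine (injective_iff_map_eq_zero _).2 fun x hx => ?_
  obtain ⟨a, rfl⟩ := mk_surjective x
  rw [← wittClass_form] at hx ⊢
  set Q := a.form
  rw [sign_wittClass] at hx
  -- the quadratic space `Q̂` and its Witt decomposition
  obtain ⟨W, hW⟩ := Q.radical.exists_isCompl
  have sQ := equivalent_restrict_prod_zero_radical Q hW.symm
  have nQ : (polarForm (Q.restrict W)).Nondegenerate :=
    nondegenerate_polarForm_of_radical_eq_bot (radical_restrict_eq_bot_of_isCompl Q hW.symm)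
  obtain ⟨n₀, m, Q₀, M, hQ₀, hM, e⟩ := exists_anisotropic_prod_metabolic (Q.restrict W) nQ
  -- signatures: `sign Q = sign Q₀`
  have hp := (sQ.trans (e.prod (QuadraticMap.Equivalent.refl _))).sigPos_eq
  have hn := (sQ.trans (e.prod (QuadraticMap.Equivalent.refl _))).sigNeg_eq
  rw [sigPos_prod, sigPos_prod] at hp
  rw [sigNeg_prod, sigNeg_prod] at hn
  have z₁ := hM.hasLagrangian.sigPos_eq_sigNeg
  have z₂ := (hasLagrangian_zero (K := 𝕜) (V := Q.radical)).sigPos_eq_sigNeg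
  have hsig : sigPos Q₀ = sigNeg Q₀ := by omega
  -- `Q₀` definite of signature `0`, nondegenerate ⇒ zero-dimensional
  have hdef := sigPos_eq_zero_or_sigNeg_eq_zero_of_anisotropic hsq hQ₀
  have hrad : finrank 𝕜 Q₀.radical = 0 := by
    rw [radical_eq_bot_of_nondegenerate (nondegenerate_polarForm_of_anisotropic' hQ₀), finrank_bot]
  have hdim := QuadraticForm.sigPos_add_sigNeg_add_radical (Q := Q₀)
  have hn₀ : finrank 𝕜 (Fin n₀ → 𝕜) = 0 := by rcases hdef with h0 | h0 <;> omega
  haveI : Subsingleton (Fin n₀ → 𝕜) :=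
    subsingleton_of_forall_eq 0 ((finrank_zero_iff_forall_zero (K := 𝕜)).1 hn₀)
  -- hence `Q` has a Lagrangian
  have hL : HasLagrangian Q :=
    ((((isMetabolic_of_subsingleton Q₀).hasLagrangian.prod hM.hasLagrangian).of_equivalent e.symm).prod
      hasLagrangian_zero).of_equivalent sQ.symm
  exact hL.wittClass_eq_zero

/-- `sign {⟨1⟩} = 1` (the form `x²` on `𝕜`). [cite: LionVergne1980, Appendix A.6, Remark] -/
theorem sign_wittClass_sq :
    sign (wittClass (QuadraticMap.weightedSumSquares 𝕜 (fun _ : Fin 1 => (1 : 𝕜)))) = 1 := by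
  rw [sign_wittClass, QuadraticForm.sigPos_weightedSumSquares, QuadraticForm.sigNeg_weightedSumSquares]
  have h₁ : {i : Fin 1 | (0 : 𝕜) < 1} = Set.univ := Set.eq_univ_of_forall fun _ => zero_lt_one
  have h₂ : {i : Fin 1 | (1 : 𝕜) < 0} = ∅ := Set.eq_empty_of_forall_notMem fun _ h => not_lt.2 zero_le_one h
  rw [h₁, h₂, Set.ncard_univ, Set.ncard_empty, Nat.card_eq_fintype_card, Fintype.card_fin]
  norm_num

/-- **`sign` is surjective** (`sign (n • {⟨1⟩}) = n`). [cite: LionVergne1980, Appendix A.6, Remark] -/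
theorem sign_surjective : Function.Surjective (sign : WittGroup 𝕜 →+ ℤ) := fun n =>
  ⟨n • wittClass (QuadraticMap.weightedSumSquares 𝕜 (fun _ : Fin 1 => (1 : 𝕜))), by
    rw [map_zsmul, sign_wittClass_sq, smul_eq_mul, mul_one]⟩

/-- **[LionVergne1980, A.6 Remark]: the signature is an isomorphism `W(𝕜) ≅ ℤ`** for an ordered field `𝕜` in
which every positive element is a square. [cite: LionVergne1980, Appendix A.6, Remark] -/
def signEquiv (hsq : ∀ a : 𝕜, 0 < a → ∃ b : 𝕜, b * b = a) : WittGroup 𝕜 ≃+ ℤ :=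
  AddEquiv.ofBijective sign ⟨sign_injective hsq, sign_surjective⟩

/-- `signEquiv` is `sign`. [cite: LionVergne1980, Appendix A.6, Remark] -/
theorem signEquiv_apply (hsq : ∀ a : 𝕜, 0 < a → ∃ b : 𝕜, b * b = a) (x : WittGroup 𝕜) :
    signEquiv hsq x = sign x := rfl

/-- **`W(ℝ) ≅ ℤ` by the signature** ("If `k = ℝ`, the map `s(E,Q) = sign Q` defines an isomorphism of `W_k` with
`ℤ`"). [cite: LionVergne1980, Appendix A.6, Remark] -/
def signEquivReal : WittGroup ℝ ≃+ ℤ :=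
  signEquiv fun a ha => ⟨Real.sqrt a, Real.mul_self_sqrt ha.le⟩

end WittGroup

end Literature.LinearAlgebra.QuadraticForm
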